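import Summits.QuantumFields.YangMills.Theorems.BalabanUVNodesC44IterMhProp4Node00
import Literature.MathematicalPhysics.QuantumFieldTheory.Balaban1983to89.B9
import Literature.MathematicalPhysics.QuantumFieldTheory.Balaban1983to89.B11KernelDictionary
import Literature.MathematicalPhysics.QuantumFieldTheory.Balaban1983to89.B5Eq118OneStroke
import Summits.QuantumFields.YangMills.Theorems.UnitScaleTiltProp7TorusExpWeightSum
import HarnessLib

/-!
# BalabanUVNodes ∕ N07 — THE (R1)-CLASS LETTER (ℓa-H) `Prop4LetterHAtRecord … b` ([B11] (46)∕(103): `‖H₁(U₀)B‖₍₁₁₅₎ ≤ b·|B|`, `b` k-FREE)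
# REDUCED BY NAME TO [B9] THEOREM 3.12 AS PRINTED (`B9.Thm312Printed`) AT A DEFINED RECORD INSTANCE, IN THE NODE-00 REGIME (`Ω_k = T`)

Track A of `YM-PLAN.md` (cell `pub-ymgap`, HUMAN RULING D-0062), DAG node **N07** = [Balaban1985Variational] («[B11]», CMP **102** (1985) 277–309); [B9] =
[Balaban1985BackgroundPropagators] (CMP **99** (1985) 389–434); [4] = [Balaban1984PropagatorsII] (CMP **96** (1984) 223–250).  Seat `pub-ymgap-dag-n07-e` (g39) = dag-lead
WORDS 790 (1) «the (R1) pen for (ℓa-H)» ∕ director-ym №578 (2)(iv); pages pre-located by lit-balaban DESK Q8 (B).  `--supports stmt-QuantumFields-27238 --as helper`; count-neutral.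

THE PRINT.  [B11] p. 285: *«L^jηQ_jHB = B on Λ_j, RD\*HB = 0, (45) and the Theorem 3.12 from [5] implies |HB| ≦ B₀(L^jη)^{−1}|B|, |∇HB| ≦ B₀(L^jη)^{−2}|B| on Ω_j. (46)»*
((103) p. 293: the same for `H₁`, same `B₀`); [B9] (3.133) p. 422: *«|H_{μν}(x, y′)|, |∇H_{μν}(x, y′)|, … ≦ O(1)[1, (L^jη)^{−1}, …](L^{j′}η)^{−d}e^{−(1∕2)δ₁d(y,y′)}, for x ∈ Δ(y), …
y ∈ Λ_j, y′ ∈ Λ_{j′}»*, Thm 3.12 p. 423 and pp. 423–424 *«common, best possible constants … B₀ … depend on d and L only»*; [4] Lemma 2.1 (2.61) p. 234 (the row sum).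
THE LETTER (def-Y ✓`Node00/BgSchemeOfRecordProp4` :163): `Prop4LetterHAtRecord F N K k Ω U₀ levB a hpos hQ b := ∀ B, ‖H₁(U₀) B‖ ≤ b·‖B‖` for the record's CONSTRUCTED
`H₁(U₀) := H1OfRecordAtBgFlat …` (lit's `G₁Q*(QG₁Q*)⁻¹` at the letters `(QOfRecord U₀, Q′♭)`), from the B-size `|·|_{(−0)}` on the k-bonds into the (115) jet space `Space115Lit`;
consumer ★ PT-B's F7 ✓`C44IterMh.prop4UniformAtRecord_node00_of_HCol` (binder `hH`, node-00 regime `∀ x, x ∈ Ω k`).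

WHAT THIS FILE DOES — the «wiring» of [B9]'s real-valued kernel schema (`B9.HKernel`, `B9.Ineq3133`, `B9.Thm312Printed`) to the letter's constructed operator, in the letter's own
carriers (the generic shape is ym3-torus' ✓`Prop7SectET3NormH1.normH_of_thm312Printed_jet` and lit's ✓`B11KernelDictionary.ineq46_of_kernelBounds`; neither is restated):
* §1 THE COLUMNS OF `H₁(U₀)`: `singleBIdx y′` (`X ↦ δ_{y′}X`), `h1Col0 y′ x = X ↦ (H₁(U₀)(δ_{y′}X))(x)`, `h1Col1 y′ p = X ↦ (∇_{U₀}H₁(U₀)(δ_{y′}X))(p)` (colour operators) — print's entries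
  `H_{1,μν}(x,y′)`, `∇H_{1,μν}(x,y′)` (`μ`∕`ν` = the directions of the fine bond `x` ∕ the k-bond `y′`; top-level pairing volume `(L^{j′}η)^d = 1`); `(H₁B)(x) = Σ_{y′} h1Col0 y′ x (B y′)`.
* §2 THE (3.133) SUP-ENTRIES `h1Entry0 y y′ := sup⁺_{x∈Δ(y)}‖h1Col0 y′ x‖`, `h1Entry1` (`Δ(y)` = fine bonds whose base k-blocks to `y.src` (`B5Eq118OneStroke.iterBlockOf k`), direction
  `y.dir`; `sup⁺` = lit's `fsup`); ★ the POINTWISE PINS `norm_eval_H1_le` ∕ `norm_nabla_H1_le` — `H₁(U₀)`, `∇_{U₀}H₁(U₀)` are READ BY THEIR ENTRIES — PROVED.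
* §3 ★★★ `prop4LetterHAtRecord_of_h1EntryBounds` (ONE MEMBER): bounds `h1Entryₙ y y′ ≤ B₀e^{−ρd(y,y′)}` in the node-00 regime ⟹ `Prop4LetterHAtRecord … (B₀·d(2(1+1∕ρ))^d)` — (46)∕(103)
  with print's `B₀` × the row-sum constant ([4] (2.61) on the record's torus = ✓`Prop7TorusExpWeightSum.sum_exp_neg_mul_tdist_le`; (115) weights `= 1`, ✓`C44IterMh.levWeight_*_eq_one`).
* §4 THE [B9] INSTANCE OF RECORD (node-00): members `MemberN00 F` = `(K, k, Mc ∣ sitesPerDir k, Ω with Ω_k = T, levB)`; `geoRecN00` (sites := the k-bonds, `scale ≡ k`, `len = L^kη_k = 1`,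
  `dist` = `tdist` of the sources, `M := Mc`; argument ∕ cut-off sorts INERT as in ✓`…N15OperatorReadout.opGeo`); `bgRecN00 F N R35 R36` (the record's backgrounds; (3.35)∕(3.36) := the
  DISPLAYED readings `R35 R36`); `h1KernelRecN00` (sup-entries := §2's at def-Y's admissible backgrounds `hpos ∧ hQ`, `0` elsewhere; Hölder entry inert).  ★★★
  `prop4LetterHAtRecord_of_thm312Printed`: `B9.Thm312Printed 4 c35 (geoRecN00 F) (bgRecN00 F N R35 R36) GD G₁ H (h1KernelRecN00 F N a R35 R36) …` (DISPLAYED; any completion of the unread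
  clauses) ⟹ `∃ M₄ a₀ b > 0, ∀ i, M₄ ≤ Mc_i → ∀ α₀ > 0, Mc_i·α₀ ≤ a₀ → ∀ U₀ ∈ R35 ∩ R36, ∀ hpos hQ, Prop4LetterHAtRecord F N i.K i.k i.Ω U₀ i.levB a hpos hQ b` — F7's `hH` at every
  member, `b = B₀·4·(2(1+2∕δ₀))⁴` bound BEFORE the member: k-FREE by the quantifier order (print's «B₀ depends on d and L only»).

HONEST FRAMING.  BY-NAME REDUCTION + kernel bookkeeping (finite sums, operator norms, scale factors `= 1`, one geometric series); NOTHING of [B9] (Thm 3.12, (3.133), the walk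
expansion) or [B11] is proved — `B9.Thm312Printed` at the record instance is a DISPLAYED hypothesis (N06's row; XL), `R35 ∕ R36` displayed readings, (ℓa-H) CONDITIONAL on them; general
`Ω`-profiles NOT treated (node-00 only, as F7); (ℓd), (117)∕Thm 3.13, (R2) untouched; K0ᴬ ⟨27238⟩ NOT closed; COUNT 8∕28 · K 1∕4 UNMOVED; one finite 𝕋⁴ programme at fixed ε — NOT
continuum ∕ OS ∕ Clay; **the Yang–Mills mass gap is NOT proved by any of this.**  No `sorry`, no `instance`, no `notation`; standard axioms.
-/

noncomputable section
open scoped Matrix Matrix.Norms.L2Operator InnerProductSpace ComplexConjugate BigOperators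
namespace Summit.QuantumFields.YangMills.BalabanUVNodes.N07Prop4LetterHOfThm312

open Literature.MathematicalPhysics.QuantumFieldTheory.Balaban1983to89
open Literature.MathematicalPhysics.QuantumFieldTheory.Balaban1983to89.Node00
open T4Continuum (T4Family)
open B9SectCLatticeCarrier (Bond)
open B11Eq115Space (NegSup NegSize Space115 JetSup levWeight)
open B11Eq111FrakG (nabla115)
open B11KernelDictionary (fsup le_fsup fsup_nonneg)
open B5Eq118OneStroke (iterBlockOf)
open Summit.QuantumFields.YangMills.Theorems.C44IterMh (L_pow_mul_eta_real levWeight_bondLevLit_eq_one levWeight_pairLevLit_eq_one)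
open Summit.QuantumFields.YangMills.Theorems.Prop7TorusExpWeightSum (sum_exp_neg_mul_tdist_le)

/-! ## §1 The columns of `H₁(U₀)`: print's kernel entries `H_{1,μν}(x, y′)`, `∇H_{1,μν}(x, y′)` as colour operators -/

section Member

variable (F : T4Family) (N : ℕ) (K k : ℕ) (Ω : ℕ → Set (Site (F.P K) 0)) (U₀ : GaugeField (F.P K) 0 (SU N)) (levB : PBond (F.P K) k → ℕ)

/-- **`Δ⁻¹` — THE OBSERVATION BLOCK OF A FINE BOND**: the k-bond `(y, μ)` with `x ∈ B^k(y)` (the `k`-fold block map `B5Eq118OneStroke.iterBlockOf k` of the bond's base, read back from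
lit's carrier by `bondToLit`) and `μ` = the direction of `x` — print's «x ∈ Δ(y), y ∈ Λ_k» with the vector index carried along.
[cite: Balaban1985BackgroundPropagators, (3.41) p.397, (3.133) p.422 («for x ∈ Δ(y)»)] -/
def blkOfBond (x : Bond (F.P K).d (fun _ => (F.P K).sitesPerDir 0)) : PBond (F.P K) k :=
  ⟨iterBlockOf k ((bondToLit (F.P K) 0).symm x).src, ((bondToLit (F.P K) 0).symm x).dir⟩

/-- **THE COORDINATE EMBEDDING `X ↦ δ_{y′}X`** of the B-index `y′ ∈ 𝔅` into the B-size `|·|_{(−0)}` (ℂ-linear). [cite: Balaban1985Variational, (45) p.285 (bookkeeping: the columns of H)] -/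
def singleBIdx (y' : PBond (F.P K) k) :
    Matrix (Fin N) (Fin N) ℂ →ₗ[ℂ] NegSize (F.L : ℝ) ((F.P K).eta k) levB 0 (Matrix (Fin N) (Fin N) ℂ) where
  toFun X := (NegSup.equiv _ _).symm (Pi.single y' X)
  map_add' X Y := by
    apply (NegSup.equiv _ _).injective
    simp [Pi.single_add]
  map_smul' c X := by
    apply (NegSup.equiv _ _).injective
    simp [Pi.single_smul]

/-- Unfolding: `δ_{y′}X` is `Pi.single y′ X` through the identification. [cite: Balaban1985Variational, (45) p.285 (bookkeeping)] -/
theorem singleBIdx_apply (y' : PBond (F.P K) k) (X : Matrix (Fin N) (Fin N) ℂ) :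
    NegSup.equiv _ _ (singleBIdx F N K k levB y' X) = Pi.single y' X := rfl

/-- **`B = Σ_{y′} δ_{y′}(B y′)`** — the B-size is spanned by its columns. [cite: Balaban1985Variational, (45) p.285 (bookkeeping)] -/
theorem sum_singleBIdx (b : NegSize (F.L : ℝ) ((F.P K).eta k) levB 0 (Matrix (Fin N) (Fin N) ℂ)) :
    ∑ y' : PBond (F.P K) k, singleBIdx F N K k levB y' (NegSup.equiv _ _ b y') = b := by
  apply (NegSup.linearEquiv ℂ (levWeight (F.L : ℝ) ((F.P K).eta k) levB 0)).injective
  rw [map_sum]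
  simp only [NegSup.linearEquiv_apply, singleBIdx_apply]
  exact Finset.univ_sum_single _

/-- The `ℓ¹` torus distance of the record's lattices is symmetric. [folklore] -/
theorem tdist_comm_rec {j : ℕ} (x y : Site (F.P K) j) : Site.tdist x y = Site.tdist y x := by
  simp only [Site.tdist, min_comm]

/-- **THE ROW SUM OVER THE B-INDEX** ([4] Lemma 2.1 (2.61) on the record's torus `T^{(k)}`, × the `d` bond directions): `Σ_{y′ ∈ 𝔅} e^{−ρ·d(y,y′)} ≤ d·(2(1+1∕ρ))^d`, uniformly in
the torus size (✓`Prop7TorusExpWeightSum.sum_exp_neg_mul_tdist_le`). [cite: Balaban1984PropagatorsII, Lemma 2.1 (2.61) p.234] -/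
theorem rowSum_PBond_le (y : PBond (F.P K) k) {ρ : ℝ} (hρ : 0 < ρ) :
    ∑ y' : PBond (F.P K) k, Real.exp (-(ρ * (Site.tdist y.src y'.src : ℝ))) ≤ (F.P K).d * (2 * (1 + 1 / ρ)) ^ (F.P K).d := by
  let e : Site (F.P K) k × Fin (F.P K).d ≃ PBond (F.P K) k := ⟨fun p => ⟨p.1, p.2⟩, fun b => (b.src, b.dir), fun _ => rfl, fun _ => rfl⟩
  rw [← Fintype.sum_equiv e (fun p => Real.exp (-(ρ * (Site.tdist y.src p.1 : ℝ)))) _ (fun _ => rfl), Fintype.sum_prod_type]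
  simp only [Finset.sum_const, Finset.card_univ, Fintype.card_fin, nsmul_eq_mul]
  rw [← Finset.mul_sum]
  refine mul_le_mul_of_nonneg_left ?_ (Nat.cast_nonneg _)
  calc ∑ s : Site (F.P K) k, Real.exp (-(ρ * (Site.tdist y.src s : ℝ)))
      = ∑ s : Site (F.P K) k, Real.exp (-(ρ * (Site.tdist s y.src : ℝ))) := Finset.sum_congr rfl fun s _ => by rw [tdist_comm_rec]
    _ ≤ (2 * (1 + 1 / ρ)) ^ (F.P K).d := sum_exp_neg_mul_tdist_le y.src hρ

variable [Fact (0 < (F.L : ℝ))] [Fact (0 < (F.P K).eta k)]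

/-- `‖B(y′)‖ ≤ |B|` — at weight exponent `0` the B-size is the plain sup norm (`(L^{j}η)^0 = 1`). [cite: Balaban1985Variational, (46) p.285 («|B|»), p.286] -/
theorem norm_apply_le_of_weightZero (b : NegSize (F.L : ℝ) ((F.P K).eta k) levB 0 (Matrix (Fin N) (Fin N) ℂ)) (y' : PBond (F.P K) k) :
    ‖NegSup.equiv _ _ b y'‖ ≤ ‖b‖ := by
  have h := NegSup.weight_mul_norm_apply_le b y'
  rwa [B11Eq115Space.levWeight_apply, pow_zero, one_mul] at h

variable [Fact (0 < c0Rec F K k)] [Fact (∀ c, 0 < wBRec F K k c)] (a : ℝ)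
  (hpos : ∀ x, x ≠ 0 → 0 < RCLike.re ⟪x, laplaceAOfRecord F N k U₀ (QOfRecord F N k U₀) (QflatOfRecord F N k) a x⟫_ℂ)
  (hQ : Function.Surjective (QOfRecord F N k U₀))

/-- **THE ZEROTH KERNEL ENTRY `H_{1,μν}(x, y′)` AS A COLOUR OPERATOR**: `X ↦ (H₁(U₀)(δ_{y′}X))(x) : M_N(ℂ) →L[ℂ] M_N(ℂ)` for the record's CONSTRUCTED `H₁(U₀) = H1OfRecordAtBgFlat …`
(`x` a fine bond of direction `μ`, `y′` a k-bond of direction `ν`; at the top level the pairing volume `(L^{j′}η)^d = 1`, so this counting-measure column IS print's entry).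
[cite: Balaban1985BackgroundPropagators, (3.129) p.421, (3.133) p.422; Balaban1985Variational, (45) p.285, (103) p.293] -/
def h1Col0 (y' : PBond (F.P K) k) (x : Bond (F.P K).d (fun _ => (F.P K).sitesPerDir 0)) :
    Matrix (Fin N) (Fin N) ℂ →L[ℂ] Matrix (Fin N) (Fin N) ℂ :=
  LinearMap.toContinuousLinearMap
    ((JetSup.evalCLM (levWeight (F.L : ℝ) ((F.P K).eta k) (bondLevLit F Ω k) 1)
        (levWeight (F.L : ℝ) ((F.P K).eta k) (pairLevLit F Ω k) 2) (nabla115 ((F.P K).eta k) (unitsOfRecord F N U₀)) x).toLinearMap ∘ₗ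
      (H1OfRecordAtBgFlat F N K k Ω U₀ levB a hpos hQ).toLinearMap ∘ₗ singleBIdx F N K k levB y')

/-- **THE FIRST KERNEL ENTRY `∇H_{1,μν}(x, y′)` AS A COLOUR OPERATOR**: `X ↦ (∇_{U₀}H₁(U₀)(δ_{y′}X))(p)`, `∇_{U₀} := nabla115 η_k (unitsOfRecord U₀)` (the ∇ the (115) space of
record is normed by), `p = (x, λ)`. [cite: Balaban1985BackgroundPropagators, (3.3) p.390, (3.133) p.422; Balaban1985Variational, (103) p.293] -/
def h1Col1 (y' : PBond (F.P K) k) (p : Bond (F.P K).d (fun _ => (F.P K).sitesPerDir 0) × Fin (F.P K).d) :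
    Matrix (Fin N) (Fin N) ℂ →L[ℂ] Matrix (Fin N) (Fin N) ℂ :=
  LinearMap.toContinuousLinearMap
    ((NegSup.evalCLM ℂ (levWeight (F.L : ℝ) ((F.P K).eta k) (pairLevLit F Ω k) 2) p).toLinearMap ∘ₗ
      (JetSup.sndCLM (levWeight (F.L : ℝ) ((F.P K).eta k) (bondLevLit F Ω k) 1)
        (levWeight (F.L : ℝ) ((F.P K).eta k) (pairLevLit F Ω k) 2) (nabla115 ((F.P K).eta k) (unitsOfRecord F N U₀))).toLinearMap ∘ₗ
      (H1OfRecordAtBgFlat F N K k Ω U₀ levB a hpos hQ).toLinearMap ∘ₗ singleBIdx F N K k levB y')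

/-- Unfolding `h1Col0`: the value of `H₁(U₀)(δ_{y′}X)` at `x`. [cite: Balaban1985BackgroundPropagators, (3.133) p.422 (bookkeeping)] -/
theorem h1Col0_apply (y' : PBond (F.P K) k) (x : Bond (F.P K).d (fun _ => (F.P K).sitesPerDir 0)) (X : Matrix (Fin N) (Fin N) ℂ) :
    h1Col0 F N K k Ω U₀ levB a hpos hQ y' x X =
      JetSup.equiv _ _ _ (H1OfRecordAtBgFlat F N K k Ω U₀ levB a hpos hQ (singleBIdx F N K k levB y' X)) x := rfl

/-- Unfolding `h1Col1`: the value of `∇_{U₀}(H₁(U₀)(δ_{y′}X))` at `p`. [cite: Balaban1985BackgroundPropagators, (3.133) p.422 (bookkeeping)] -/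
theorem h1Col1_apply (y' : PBond (F.P K) k) (p : Bond (F.P K).d (fun _ => (F.P K).sitesPerDir 0) × Fin (F.P K).d)
    (X : Matrix (Fin N) (Fin N) ℂ) :
    h1Col1 F N K k Ω U₀ levB a hpos hQ y' p X =
      nabla115 ((F.P K).eta k) (unitsOfRecord F N U₀)
        (JetSup.equiv _ _ _ (H1OfRecordAtBgFlat F N K k Ω U₀ levB a hpos hQ (singleBIdx F N K k levB y' X))) p := rfl

/-- **`(H₁B)(x) = Σ_{y′} H₁(x, y′)[B(y′)]`** — the record's `H₁(U₀)` IS the kernel operator of its columns (linearity over `B = Σ_{y′} δ_{y′}(B y′)`).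
[cite: Balaban1985BackgroundPropagators, (3.129) p.421, (3.133) p.422 (bookkeeping)] -/
theorem eval_H1_eq_sum_h1Col0 (b : NegSize (F.L : ℝ) ((F.P K).eta k) levB 0 (Matrix (Fin N) (Fin N) ℂ))
    (x : Bond (F.P K).d (fun _ => (F.P K).sitesPerDir 0)) :
    JetSup.equiv _ _ _ (H1OfRecordAtBgFlat F N K k Ω U₀ levB a hpos hQ b) x =
      ∑ y' : PBond (F.P K) k, h1Col0 F N K k Ω U₀ levB a hpos hQ y' x (NegSup.equiv _ _ b y') := by
  conv_lhs => rw [← sum_singleBIdx F N K k levB b]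
  rw [map_sum, ← JetSup.evalCLM_apply, map_sum]
  rfl

/-- **`(∇_{U₀}H₁B)(p) = Σ_{y′} ∇H₁(p, y′)[B(y′)]`** — the same for the covariant-derivative entries. [cite: Balaban1985BackgroundPropagators, (3.133) p.422 (bookkeeping)] -/
theorem nabla_H1_eq_sum_h1Col1 (b : NegSize (F.L : ℝ) ((F.P K).eta k) levB 0 (Matrix (Fin N) (Fin N) ℂ))
    (p : Bond (F.P K).d (fun _ => (F.P K).sitesPerDir 0) × Fin (F.P K).d) :
    nabla115 ((F.P K).eta k) (unitsOfRecord F N U₀) (JetSup.equiv _ _ _ (H1OfRecordAtBgFlat F N K k Ω U₀ levB a hpos hQ b)) p =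
      ∑ y' : PBond (F.P K) k, h1Col1 F N K k Ω U₀ levB a hpos hQ y' p (NegSup.equiv _ _ b y') := by
  rw [show nabla115 ((F.P K).eta k) (unitsOfRecord F N U₀) (JetSup.equiv _ _ _ (H1OfRecordAtBgFlat F N K k Ω U₀ levB a hpos hQ b)) p =
      NegSup.evalCLM ℂ (levWeight (F.L : ℝ) ((F.P K).eta k) (pairLevLit F Ω k) 2) p
        (JetSup.sndCLM (levWeight (F.L : ℝ) ((F.P K).eta k) (bondLevLit F Ω k) 1)
          (levWeight (F.L : ℝ) ((F.P K).eta k) (pairLevLit F Ω k) 2) (nabla115 ((F.P K).eta k) (unitsOfRecord F N U₀))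
          (H1OfRecordAtBgFlat F N K k Ω U₀ levB a hpos hQ b)) from rfl]
  conv_lhs => rw [← sum_singleBIdx F N K k levB b]
  rw [map_sum, map_sum, map_sum]
  rfl

/-! ## §2 The (3.133) sup-entries of record and the two pointwise pins -/

open Classical in
/-- **`sup_{x∈Δ(y)}|H_{1,μν}(x, y′)|` OF RECORD** — the zeroth (3.133) entry: the block sup (lit's `fsup`, floor `0`) over the fine bonds `x` of the observation block `y = (site, μ)` of the
operator norms of the columns `h1Col0 y′ x` (colour indices in operator norm). [cite: Balaban1985BackgroundPropagators, (3.133) p.422] -/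
def h1Entry0 (y y' : PBond (F.P K) k) : ℝ :=
  fsup fun x : Bond (F.P K).d (fun _ => (F.P K).sitesPerDir 0) =>
    if blkOfBond F K k x = y then ‖h1Col0 F N K k Ω U₀ levB a hpos hQ y' x‖ else 0

open Classical in
/-- **`sup_{x∈Δ(y)}|∇H_{1,μν}(x, y′)|` OF RECORD** — the first (3.133) entry (sup over the block's fine bonds and the derivative direction). [cite: Balaban1985BackgroundPropagators, (3.133) p.422] -/
def h1Entry1 (y y' : PBond (F.P K) k) : ℝ :=
  fsup fun p : Bond (F.P K).d (fun _ => (F.P K).sitesPerDir 0) × Fin (F.P K).d =>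
    if blkOfBond F K k p.1 = y then ‖h1Col1 F N K k Ω U₀ levB a hpos hQ y' p‖ else 0

/-- Each column is dominated by the entry of its observation block: `‖h1Col0 y′ x‖ ≤ h1Entry0 Δ⁻¹(x) y′`. [cite: Balaban1985BackgroundPropagators, (3.133) p.422 (bookkeeping)] -/
theorem opNorm_col0_le_h1Entry0 (y' : PBond (F.P K) k) (x : Bond (F.P K).d (fun _ => (F.P K).sitesPerDir 0)) :
    ‖h1Col0 F N K k Ω U₀ levB a hpos hQ y' x‖ ≤ h1Entry0 F N K k Ω U₀ levB a hpos hQ (blkOfBond F K k x) y' := by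
  classical
  unfold h1Entry0
  refine le_trans (le_of_eq ?_) (le_fsup _ x)
  rw [if_pos rfl]

/-- `‖h1Col1 y′ p‖ ≤ h1Entry1 Δ⁻¹(p) y′`. [cite: Balaban1985BackgroundPropagators, (3.133) p.422 (bookkeeping)] -/
theorem opNorm_col1_le_h1Entry1 (y' : PBond (F.P K) k) (p : Bond (F.P K).d (fun _ => (F.P K).sitesPerDir 0) × Fin (F.P K).d) :
    ‖h1Col1 F N K k Ω U₀ levB a hpos hQ y' p‖ ≤ h1Entry1 F N K k Ω U₀ levB a hpos hQ (blkOfBond F K k p.1) y' := by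
  classical
  unfold h1Entry1
  refine le_trans (le_of_eq ?_) (le_fsup _ p)
  rw [if_pos rfl]

/-- ★ **PIN 0 — `H₁(U₀)` IS READ BY ITS ZEROTH ENTRIES**: `‖(H₁B)(x)‖ ≤ (Σ_{y′} sup_{Δ(y)∋x}|H₁(·, y′)|)·|B|` (PROVED: §1's column sum, triangle inequality, operator norm,
`‖B(y′)‖ ≤ |B|`). [cite: Balaban1985BackgroundPropagators, (3.133) p.422; Balaban1985Variational, (46) p.285; Balaban1984PropagatorsII, (2.52)–(2.55) pp.232–233] -/
theorem norm_eval_H1_le (b : NegSize (F.L : ℝ) ((F.P K).eta k) levB 0 (Matrix (Fin N) (Fin N) ℂ))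
    (x : Bond (F.P K).d (fun _ => (F.P K).sitesPerDir 0)) :
    ‖JetSup.equiv _ _ _ (H1OfRecordAtBgFlat F N K k Ω U₀ levB a hpos hQ b) x‖ ≤
      (∑ y' : PBond (F.P K) k, h1Entry0 F N K k Ω U₀ levB a hpos hQ (blkOfBond F K k x) y') * ‖b‖ := by
  rw [eval_H1_eq_sum_h1Col0, Finset.sum_mul]
  refine (norm_sum_le _ _).trans (Finset.sum_le_sum fun y' _ => ?_)
  calc ‖h1Col0 F N K k Ω U₀ levB a hpos hQ y' x (NegSup.equiv _ _ b y')‖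
      ≤ ‖h1Col0 F N K k Ω U₀ levB a hpos hQ y' x‖ * ‖NegSup.equiv _ _ b y'‖ := ContinuousLinearMap.le_opNorm _ _
    _ ≤ h1Entry0 F N K k Ω U₀ levB a hpos hQ (blkOfBond F K k x) y' * ‖b‖ :=
        mul_le_mul (opNorm_col0_le_h1Entry0 F N K k Ω U₀ levB a hpos hQ y' x) (norm_apply_le_of_weightZero F N K k levB b y')
          (norm_nonneg _) (fsup_nonneg _)

/-- ★ **PIN 1 — `∇_{U₀}H₁(U₀)` IS READ BY ITS FIRST ENTRIES**: `‖(∇_{U₀}H₁B)(p)‖ ≤ (Σ_{y′} sup_{Δ(y)∋p}|∇H₁(·, y′)|)·|B|`.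
[cite: Balaban1985BackgroundPropagators, (3.133) p.422; Balaban1985Variational, (46) p.285; Balaban1984PropagatorsII, (2.52)–(2.55) pp.232–233] -/
theorem norm_nabla_H1_le (b : NegSize (F.L : ℝ) ((F.P K).eta k) levB 0 (Matrix (Fin N) (Fin N) ℂ))
    (p : Bond (F.P K).d (fun _ => (F.P K).sitesPerDir 0) × Fin (F.P K).d) :
    ‖nabla115 ((F.P K).eta k) (unitsOfRecord F N U₀) (JetSup.equiv _ _ _ (H1OfRecordAtBgFlat F N K k Ω U₀ levB a hpos hQ b)) p‖ ≤
      (∑ y' : PBond (F.P K) k, h1Entry1 F N K k Ω U₀ levB a hpos hQ (blkOfBond F K k p.1) y') * ‖b‖ := by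
  rw [nabla_H1_eq_sum_h1Col1, Finset.sum_mul]
  refine (norm_sum_le _ _).trans (Finset.sum_le_sum fun y' _ => ?_)
  calc ‖h1Col1 F N K k Ω U₀ levB a hpos hQ y' p (NegSup.equiv _ _ b y')‖
      ≤ ‖h1Col1 F N K k Ω U₀ levB a hpos hQ y' p‖ * ‖NegSup.equiv _ _ b y'‖ := ContinuousLinearMap.le_opNorm _ _
    _ ≤ h1Entry1 F N K k Ω U₀ levB a hpos hQ (blkOfBond F K k p.1) y' * ‖b‖ :=
        mul_le_mul (opNorm_col1_le_h1Entry1 F N K k Ω U₀ levB a hpos hQ y' p) (norm_apply_le_of_weightZero F N K k levB b y')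
          (norm_nonneg _) (fsup_nonneg _)

/-! ## §3 One member: the letter from (3.133)-shaped entry bounds, node-00 regime -/

/-- ★★★ **(ℓa-H) AT ONE MEMBER FROM (3.133)-SHAPED ENTRY BOUNDS, NODE-00 REGIME** — [B11] (46)∕(103) ⇐ [B9] (3.133) + [4] (2.61): if every site lies in `Ω_k` and the two
sup-entries of `H₁(U₀)` obey `h1Entryₙ y y′ ≤ B₀e^{−ρd(y,y′)}` ((3.133) for `H₁` at the top level, where `(L^kη_k)^{−n}(L^kη_k)^{−d} = 1`; `d` = `tdist` of the sources), then
`‖H₁(U₀)B‖₍₁₁₅₎ ≤ B₀·(d(2(1+1∕ρ))^d)·|B|` — the letter with `b = B₀ × (row-sum constant)`, a closed term in `(B₀, ρ, d)`: k-FREE given k-free `(B₀, ρ)`; (115) weights `= 1`.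
[cite: Balaban1985Variational, (46) p.285, (103) p.293, (115) p.294; Balaban1985BackgroundPropagators, (3.133) p.422, Thm 3.12 pp.423–424; Balaban1984PropagatorsII, (2.61) p.234] -/
theorem prop4LetterHAtRecord_of_h1EntryBounds (hΩ : ∀ x, x ∈ Ω k) {B₀ ρ : ℝ} (hB₀ : 0 ≤ B₀) (hρ : 0 < ρ)
    (h0 : ∀ y y' : PBond (F.P K) k, h1Entry0 F N K k Ω U₀ levB a hpos hQ y y' ≤ B₀ * Real.exp (-(ρ * (Site.tdist y.src y'.src : ℝ))))
    (h1 : ∀ y y' : PBond (F.P K) k, h1Entry1 F N K k Ω U₀ levB a hpos hQ y y' ≤ B₀ * Real.exp (-(ρ * (Site.tdist y.src y'.src : ℝ)))) :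
    Prop4LetterHAtRecord F N K k Ω U₀ levB a hpos hQ (B₀ * ((F.P K).d * (2 * (1 + 1 / ρ)) ^ (F.P K).d)) := by
  have hC0 : (0 : ℝ) ≤ (F.P K).d * (2 * (1 + 1 / ρ)) ^ (F.P K).d := by positivity
  have hrow : ∀ y : PBond (F.P K) k,
      ∑ y' : PBond (F.P K) k, B₀ * Real.exp (-(ρ * (Site.tdist y.src y'.src : ℝ))) ≤ B₀ * ((F.P K).d * (2 * (1 + 1 / ρ)) ^ (F.P K).d) :=
    fun y => by rw [← Finset.mul_sum]; exact mul_le_mul_of_nonneg_left (rowSum_PBond_le F K k y hρ) hB₀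
  intro b
  have hb : 0 ≤ B₀ * ((F.P K).d * (2 * (1 + 1 / ρ)) ^ (F.P K).d) * ‖b‖ := mul_nonneg (mul_nonneg hB₀ hC0) (norm_nonneg b)
  refine (JetSup.norm_le_iff_pointwise hb).2 ⟨fun x => ?_, fun p => ?_⟩
  · rw [levWeight_bondLevLit_eq_one F k Ω hΩ x, one_mul]
    refine (norm_eval_H1_le F N K k Ω U₀ levB a hpos hQ b x).trans (mul_le_mul_of_nonneg_right ?_ (norm_nonneg b))
    exact (Finset.sum_le_sum fun y' _ => h0 _ y').trans (hrow _)
  · rw [levWeight_pairLevLit_eq_one F K k Ω hΩ p, one_mul]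
    refine (norm_nabla_H1_le F N K k Ω U₀ levB a hpos hQ b p).trans (mul_le_mul_of_nonneg_right ?_ (norm_nonneg b))
    exact (Finset.sum_le_sum fun y' _ => h1 _ y').trans (hrow _)

end Member
/-! ## §4 The [B9] instance of record in the node-00 regime; the letter from `B9.Thm312Printed` BY NAME -/

section Family

variable (F : T4Family) (N : ℕ) (a : ℝ)

/-- **A MEMBER OF THE NODE-00 FAMILY OF RECORD**: `K` (`ε = L^{−K}`), the step `k`, the cube letter `Mc ∣ sitesPerDir k` (print's `M`-cubes partition `T^{(k)}`), a domain
sequence `Ω` with `Ω_k = T` (every level is `k`) and the B-index levels `levB` (unread at weight `0`); the scheme's `a` and the colour number `N` are family-wide. [cite: Balaban1985BackgroundPropagators, p.396 («cube □ of the described above class», «O(1)M is a size of □»), Thm 3.12 p.423] -/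
structure MemberN00 (F : T4Family) : Type where
  /-- approximation index (`ε = L^{-K}`) -/
  K : ℕ
  /-- the renormalisation step -/
  k : ℕ
  /-- the cube letter `M` -/
  Mc : ℕ
  /-- the `M`-cubes partition `T^{(k)}` -/
  hMc : Mc ∣ (F.P K).sitesPerDir k
  /-- the domain sequence -/
  Ω : ℕ → Set (Site (F.P K) 0)
  /-- node-00 regime: every site lies in `Ω_k` -/
  hΩ : ∀ x, x ∈ Ω k
  /-- block levels of the B-index -/
  levB : PBond (F.P K) k → ℕ

/-- **THE [B9] GEOMETRY OF RECORD AT A NODE-00 MEMBER**: sites 𝔅 := the k-bonds (the B-index of `H₁`'s domain), every scale `= k`, `η = η_k`, `L` (so `len = L^kη_k = 1`), `dist` =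
the `ℓ¹` torus distance of the sources, `M := Mc`; the argument ∕ cut-off sorts (read only by the G-clauses and the Hölder entry, none read here) are INERT (`Unit`, `0`, `True`)
as in ✓`…N15OperatorReadout.opGeo`. [cite: Balaban1985BackgroundPropagators, Sect. A (3.39)–(3.41) pp.396–397 (typing template)] -/
@[reducible] def geoRecN00 (i : MemberN00 F) : B9.Geometry where
  Site := PBond (F.P i.K) i.k
  scale := fun _ => i.k
  dist := fun y y' => (Site.tdist y.src y'.src : ℝ)
  k := i.k
  eta := (F.P i.K).eta i.k
  L := F.L
  M := i.Mc
  Loc := Unit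
  suppIn := fun _ _ => True
  suppInT := fun _ _ => True
  supNorm := fun _ => 0
  l2Norm := fun _ => 0
  wNorm := fun _ _ => 0
  holder := fun _ _ => 0
  Cut := Unit
  cutIn := fun _ _ => True
  cutInT := fun _ _ => True
  cutH := fun _ _ => 0
  cutSup := fun _ => 0
  suppInT_of_suppIn := fun _ _ h => h
  cutInT_of_cutIn := fun _ _ h => h

/-- **`L^kη_k = 1`**: every scale length of the node-00 geometry of record is `1`. [cite: Balaban1987RG1, (1.1)–(1.2) p.260; Balaban1985BackgroundPropagators, (3.41) p.397] -/
theorem geoRecN00_len (i : MemberN00 F) (y : (geoRecN00 F i).Site) : (geoRecN00 F i).len y = 1 :=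
  L_pow_mul_eta_real F i.k

/-- **THE [B9] BACKGROUNDS OF RECORD**: configurations := `GaugeField (F.P K) 0 (SU N)` (unit, pointwise product); (3.35)∕(3.36) := the DISPLAYED readings `R35 ∕ R36`, pinned by
whoever supplies Theorem 3.12 at the record (the tree's typings live on def-Y's `KIdx` carriers, e.g. `B9BackgroundsKLevelV1P.Reg335PC`; [B11] p.280–281 «(3.35) … is satisfied for U₀
also», `α₀ = ε₀`); the complex classes (3.37)∕(3.38) are inert (`False`). [cite: Balaban1985BackgroundPropagators, (3.35)–(3.38) p.396; Balaban1985Variational, p.280–281] -/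
@[reducible] def bgRecN00 (R35 R36 : ∀ i : MemberN00 F, ℝ → ℝ → GaugeField (F.P i.K) 0 (SU N) → Prop) (i : MemberN00 F) : B9.Backgrounds where
  Cfg := GaugeField (F.P i.K) 0 (SU N)
  one := fun _ => 1
  mul := fun U V b => U b * V b
  Reg335 := R35 i
  Reg336 := R36 i
  Cplx337 := fun _ _ _ => False
  Cplx338 := fun _ _ _ => False

open Classical in
/-- **THE H₁-KERNEL OF RECORD** (`B9.HKernel`: the REAL quantities (3.133) bounds): at a background ADMISSIBLE for def-Y's scheme (displayed proofs `hpos` — [B9] Thm 3.11 for `Δ_{1,a}(U₀)`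
at `(Q(U₀), Q′♭)` — and `hQ` — `Q(U₀)` onto) the sup-entries `e 0 ∕ e 1` ARE §2's `h1Entry0 ∕ h1Entry1` (`h1KernelRecN00_e_eq`); elsewhere the scheme defines no `H₁(U₀)`
and they read `0` ((3.133) void there); the Hölder entry is inert (`0`) — (46) reads only the two sup members (as lit's `B11KernelDictionary` §9). [cite: Balaban1985BackgroundPropagators, (3.133) p.422, (3.129) p.421, Thm 3.11 p.416; Balaban1985Variational, (45)–(46) p.285, (110) p.294] -/
def h1KernelRecN00 [Fact (0 < (F.L : ℝ))] (R35 R36 : ∀ i : MemberN00 F, ℝ → ℝ → GaugeField (F.P i.K) 0 (SU N) → Prop) (i : MemberN00 F) :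
    B9.HKernel (geoRecN00 F i) (bgRecN00 F N R35 R36 i) where
  e := fun n U y y' =>
    haveI := factEta F i.K i.k
    haveI := factC0 F i.K i.k
    haveI := wBRec_fact F i.K i.k
    if h : (∀ x, x ≠ 0 → 0 < RCLike.re ⟪x, laplaceAOfRecord F N i.k U (QOfRecord F N i.k U) (QflatOfRecord F N i.k) a x⟫_ℂ) ∧
        Function.Surjective (QOfRecord F N i.k U) then
      (if (n : ℕ) = 0 then h1Entry0 F N i.K i.k i.Ω U i.levB a h.1 h.2 y y' else h1Entry1 F N i.K i.k i.Ω U i.levB a h.1 h.2 y y')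
    else 0
  h := fun _ _ _ _ => 0

/-- Unfolding at an admissible background: `e n = h1Entryₙ` (`n = 0, 1`). [cite: Balaban1985BackgroundPropagators, (3.133) p.422 (bookkeeping)] -/
theorem h1KernelRecN00_e_eq [Fact (0 < (F.L : ℝ))] (R35 R36 : ∀ i : MemberN00 F, ℝ → ℝ → GaugeField (F.P i.K) 0 (SU N) → Prop) (i : MemberN00 F)
    (U₀ : GaugeField (F.P i.K) 0 (SU N))
    (hpos : haveI := factC0 F i.K i.k; haveI := wBRec_fact F i.K i.k
      ∀ x, x ≠ 0 → 0 < RCLike.re ⟪x, laplaceAOfRecord F N i.k U₀ (QOfRecord F N i.k U₀) (QflatOfRecord F N i.k) a x⟫_ℂ)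
    (hQ : haveI := wBRec_fact F i.K i.k; Function.Surjective (QOfRecord F N i.k U₀)) (n : Fin 2) (y y' : PBond (F.P i.K) i.k) :
    (h1KernelRecN00 F N a R35 R36 i).e n U₀ y y' =
      (haveI := factEta F i.K i.k; haveI := factC0 F i.K i.k; haveI := wBRec_fact F i.K i.k
        if (n : ℕ) = 0 then h1Entry0 F N i.K i.k i.Ω U₀ i.levB a hpos hQ y y' else h1Entry1 F N i.K i.k i.Ω U₀ i.levB a hpos hQ y y') := by
  simp only [h1KernelRecN00, dif_pos (And.intro hpos hQ)]

/-- ★★★ **(ℓa-H) FROM [B9] THEOREM 3.12 AS PRINTED, BY NAME, AT THE RECORD (NODE-00 REGIME)** — [B11] p. 285 «the Theorem 3.12 from [5] implies (46)» as a kernel-checked implication: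
IF `B9.Thm312Printed 4 c35 (geoRecN00 F) (bgRecN00 F N R35 R36) GD G₁ H (h1KernelRecN00 F N a R35 R36) …` holds (the ∃-package `M₄ δ₀ a₀ B₀ …` BEFORE the member; ANY completion of the
clauses not read here — only the `H₁`-clause (3.133) is used) THEN `∃ M₄ a₀ b > 0` with, for EVERY member `i` (`M₄ ≤ Mc_i`), every `0 < α₀` (`Mc_i·α₀ ≤ a₀`), every `U₀` in the displayed
classes `R35 ∕ R36 i c35 α₀` and every pair of def-Y's displayed proofs `hpos hQ`: `Prop4LetterHAtRecord F N i.K i.k i.Ω U₀ i.levB a hpos hQ b` — F7's binder `hH` verbatim, `b =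
B₀·4·(2(1+2∕δ₀))⁴` bound BEFORE `K, k, Mc, Ω, U₀`: k-FREE by the quantifier order («B₀ depends on d and L only»).  Proof: the `H₁`-clause at `len = 1` is §3's hypothesis, `ρ = δ₀∕2`.
DISPLAYED, not proved: Theorem 3.12 (N06's row, XL), the readings `R35 ∕ R36`. [cite: Balaban1985Variational, (45)–(46) p.285, (103) p.293; Balaban1985BackgroundPropagators, Thm 3.12 pp.421–424, (3.133) p.422, (3.35)–(3.36) p.396; Balaban1984PropagatorsII, (2.61) p.234] -/
theorem prop4LetterHAtRecord_of_thm312Printed [Fact (0 < (F.L : ℝ))] {c35 : ℝ}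
    {R35 R36 : ∀ i : MemberN00 F, ℝ → ℝ → GaugeField (F.P i.K) 0 (SU N) → Prop}
    {GD G₁ : ∀ i : MemberN00 F, B9.KernelFamily (geoRecN00 F i) (bgRecN00 F N R35 R36 i)}
    {H : ∀ i : MemberN00 F, B9.HKernel (geoRecN00 F i) (bgRecN00 F N R35 R36 i)}
    {HasRWExp : ∀ i : MemberN00 F, B9.KernelFamily (geoRecN00 F i) (bgRecN00 F N R35 R36 i) → (bgRecN00 F N R35 R36 i).Cfg → ℝ → Prop}
    {HasRWExpH : ∀ i : MemberN00 F, B9.HKernel (geoRecN00 F i) (bgRecN00 F N R35 R36 i) → (bgRecN00 F N R35 R36 i).Cfg → ℝ → Prop}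
    {PosDefK : ∀ i : MemberN00 F, B9.KernelFamily (geoRecN00 F i) (bgRecN00 F N R35 R36 i) → (bgRecN00 F N R35 R36 i).Cfg → Prop}
    (h312 : B9.Thm312Printed 4 c35 (geoRecN00 F) (bgRecN00 F N R35 R36) GD G₁ H (h1KernelRecN00 F N a R35 R36) HasRWExp HasRWExpH PosDefK) :
    ∃ M₄ a₀ b : ℝ, 0 < M₄ ∧ 0 < a₀ ∧ 0 < b ∧
      ∀ i : MemberN00 F, M₄ ≤ (i.Mc : ℝ) → ∀ α₀ : ℝ, 0 < α₀ → (i.Mc : ℝ) * α₀ ≤ a₀ →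
        ∀ U₀ : GaugeField (F.P i.K) 0 (SU N), R35 i c35 α₀ U₀ → R36 i c35 α₀ U₀ →
          haveI := factEta F i.K i.k
          haveI := factC0 F i.K i.k
          haveI := wBRec_fact F i.K i.k
          ∀ (hpos : ∀ x, x ≠ 0 → 0 < RCLike.re ⟪x, laplaceAOfRecord F N i.k U₀ (QOfRecord F N i.k U₀) (QflatOfRecord F N i.k) a x⟫_ℂ)
            (hQ : Function.Surjective (QOfRecord F N i.k U₀)),
            Prop4LetterHAtRecord F N i.K i.k i.Ω U₀ i.levB a hpos hQ b := by
  obtain ⟨M₄, δ₀, a₀, B₀, Bβ, _Bε, _Bεβ, hM₄, hδ₀, ha₀, hB₀, h⟩ := h312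
  refine ⟨M₄, a₀, B₀ * (4 * (2 * (1 + 1 / (δ₀ / 2))) ^ 4), hM₄, ha₀, by positivity, fun i hM α₀ hα₀ hMa U₀ h35 h36 hpos hQ => ?_⟩
  haveI := factEta F i.K i.k
  haveI := factC0 F i.K i.k
  haveI := wBRec_fact F i.K i.k
  have hmem : h1KernelRecN00 F N a R35 R36 i ∈ [H i, h1KernelRecN00 F N a R35 R36 i] := by simp
  have h3133 := ((h i hM α₀ hα₀ hMa U₀ h35 h36).2 _ hmem).1
  have hent : ∀ (n : Fin 2) (y y' : PBond (F.P i.K) i.k),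
      (h1KernelRecN00 F N a R35 R36 i).e n U₀ y y' ≤ B₀ * Real.exp (-(δ₀ / 2 * (Site.tdist y.src y'.src : ℝ))) := by
    intro n y y'
    have h1 := h3133.1 n y y'
    rw [geoRecN00_len, geoRecN00_len, Real.one_rpow, Real.one_rpow, mul_one, mul_one] at h1
    exact h1
  refine prop4LetterHAtRecord_of_h1EntryBounds F N i.K i.k i.Ω U₀ i.levB a hpos hQ i.hΩ hB₀.le (half_pos hδ₀) (fun y y' => ?_) (fun y y' => ?_)
  · simpa only [h1KernelRecN00_e_eq F N a R35 R36 i U₀ hpos hQ, Fin.val_zero, if_true] using hent 0 y y'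
  · simpa only [h1KernelRecN00_e_eq F N a R35 R36 i U₀ hpos hQ, Fin.val_one, one_ne_zero, if_false] using hent 1 y y'

end Family

end Summit.QuantumFields.YangMills.BalabanUVNodes.N07Prop4LetterHOfThm312
end
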